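import Summits.Parity.GeneralizedHardyLittlewood.Theorems.BeyondDiagonalBeatsQuarter.KernelFormXSqBridge
import HarnessLib

/-!
# The exact main-term collapses of the `X²` kernel form: `Σ|W|S = W₂`, `Σ|W|P = W₃ − ℓW₂`, `φW²E = ζ(2)|W|`

Supports stmt-Parity-20343 (`PrimeLevelFamEdge.BeyondDiagonalBeatsQuarter`, K_B; line
`diagonal_kernel_split`, registered stub `stub_kernelFormXSq`). A helper; it closes nothing. Namespace
`Summit.Parity.GeneralizedHardyLittlewood.Theorems.BeyondDiagonalBeatsQuarter.KernelFormXSq`.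

The kernel form is `ℓ⁻⁴Σ_n φ(n)W(n)²((L+κ(n))S_n² + 2S_nP_n)` (`KernelFormXSqBridge`), with
`S_n = 2E_n + δ_n` (`KernelFormXSqCore`). The main terms come from EXACT identities (unitary
convolutions of functions supported on squarefree numbers), which is what makes the `X²` case
hand-able — no two-sided estimate for `Σ μ²/φ` or Mertens' theorem is needed:

* `totient_mul_W_sq_mul_mainConst` — `φ(n)W(n)²E_n = ζ(2)|W(n)|`;
* `sum_absW_coprimeSum` — `Σ_{n ≤ M} |W(n)|·S(M/n;n) = W₂(M)` (`(μ ∗ τ) = 1`);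
* `sum_absW_primeSum` — `Σ_{n ≤ M} |W(n)|·P_n = Σ_{n ≤ M} |W(n)| log n·S(M/n;n)`;
* `sum_absW_log_coprimeSum` — `Σ_{n ≤ M} |W(n)| log n·S(M/n;n) = W₃(M) − log M·W₂(M)`
  (`((μ·log) ∗ τ) = −log`),
where `W_j(M) = Σ_{m ≤ M} W(m)logʲ(M/m)` is the tree's `weightLogPowSum j M`
(`= ζ(2)j log^{j−1}M + O(log^{j−2}M)`, `abs_weightLogPowSum_sub_le`). Everything here is PROVED
(theorems only).

## References
* E. Kowalski, P. Michel, J. VanderKam, J. reine angew. Math. 526 (2000), Prop. 5.1 (31) p. 18 (the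
  two constants `ζ(2)²P′(1)²` and `ζ(2)²∫P″²` at `P = X²`). [cite: KowalskiMichelVanderKam2000, Prop. 5.1 — derivation]
«The programme SEARCHES and TYPES; no claim about Landau–Siegel zeros, Theorems 1–2 of
arXiv:2211.02515 or a repaired Margin232 until a kernel theorem says so.»
-/

noncomputable section

open scoped Real ArithmeticFunction.Moebius ArithmeticFunction.sigma ArithmeticFunction.zeta
open Finset ArithmeticFunction

namespace Summit.Parity.GeneralizedHardyLittlewood.Theorems.BeyondDiagonalBeatsQuarter.KernelFormXSq

open Literature.NumberTheory.LFunctions Literature.NumberTheory.LFunctions.KMV2000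
open MollifierMainTerm (W G invA weightLogPowSum)
open Literature.Barriers.Parity (Icc_one_eq_Ioc_zero)

/-! ### `φ(n)W(n)²E_n = ζ(2)|W(n)|` -/

/-- **`φ(n)W(n)²·E_n = (π²/6)·|W(n)|`** (`n ≥ 1`): for squarefree `n`,
`∏(p−1)·∏(p+1)⁻²·∏(p+1)/(p−1) = ∏(p+1)⁻¹`; both sides vanish otherwise.
[cite: KowalskiMichelVanderKam2000, Prop. 5.1 — derivation (the constant ζ(2)²)] -/
theorem totient_mul_W_sq_mul_mainConst {n : ℕ} (hn : n ≠ 0) :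
    (Nat.totient n : ℝ) * W n ^ 2 * mainConst n = π ^ 2 / 6 * |W n| := by
  by_cases hsq : Squarefree n
  · set S := n.primeFactors with hS
    set P : ℝ := ∏ p ∈ S, ((p : ℝ) + 1) with hP
    set Q : ℝ := ∏ p ∈ S, ((p : ℝ) - 1) with hQ
    have hP0 : 0 < P := Finset.prod_pos fun p _ ↦ by positivity
    have hQ0 : 0 < Q := Finset.prod_pos fun p hp ↦ by
      have : (2 : ℝ) ≤ p := by exact_mod_cast (Nat.prime_of_mem_primeFactors hp).two_le
      linarith
    -- `φ(n) = Q`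
    have hphi : (Nat.totient n : ℝ) = Q := by
      have h := Nat.totient_mul_prod_primeFactors n
      rw [Nat.prod_primeFactors_of_squarefree hsq] at h
      have h' : Nat.totient n = ∏ p ∈ S, (p - 1) :=
        Nat.eq_of_mul_eq_mul_right (Nat.pos_of_ne_zero hn) (by rw [h, mul_comm])
      rw [h', Nat.cast_prod]
      refine Finset.prod_congr rfl fun p hp ↦ ?_
      rw [Nat.cast_sub (Nat.prime_of_mem_primeFactors hp).one_lt.le, Nat.cast_one]
    -- `ψ(n)·n = P`
    have hpsi : psi n * (n : ℝ) = P := by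
      rw [psi, ← hS]
      conv_lhs => rw [← Nat.prod_primeFactors_of_squarefree hsq]
      rw [← hS, Nat.cast_prod, ← Finset.prod_mul_distrib]
      refine Finset.prod_congr rfl fun p hp ↦ ?_
      have hp0 : (p : ℝ) ≠ 0 := by exact_mod_cast (Nat.prime_of_mem_primeFactors hp).ne_zero
      field_simp
    have hn0 : (n : ℝ) ≠ 0 := by exact_mod_cast hn
    have habsW : |W n| = P⁻¹ := by
      rw [W_apply'' hn, abs_mul, abs_mul]
      have hmu : |(μ n : ℝ)| = 1 := by
        rw [ArithmeticFunction.moebius_apply_of_squarefree hsq]; push_cast; simp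
      have hpsi0 : 0 < psi n := Finset.prod_pos fun p _ ↦ by positivity
      rw [hmu, one_mul, abs_of_nonneg (inv_nonneg.2 hpsi0.le),
        abs_of_nonneg (by positivity), ← mul_inv, hpsi]
    have hWsq : W n ^ 2 = P⁻¹ ^ 2 := by rw [← sq_abs, habsW]
    have hE : mainConst n = π ^ 2 / 6 * (P / Q) := by
      rw [mainConst, ← hS, Finset.prod_div_distrib]
    rw [hphi, hWsq, hE, habsW]
    field_simp
  · rw [W_eq_zero_of_not_squarefree hsq]; simp

/-! ### Divisor-sum identities: `(μ ∗ τ) = 1`, `((μ·log) ∗ τ) = −log` -/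

/-- `Σ_{d∣q} μ(d)τ(q/d) = 1` for `q ≥ 1` (`μ ∗ ζ ∗ ζ = ζ`). [folklore] -/
theorem sum_moebius_mul_card_divisors_div {q : ℕ} (hq : q ≠ 0) :
    ∑ d ∈ q.divisors, (μ d : ℝ) * ((q / d).divisors.card : ℝ) = 1 := by
  have hσ : ((σ 0 : ArithmeticFunction ℕ) : ArithmeticFunction ℝ) =
      (ζ : ArithmeticFunction ℝ) * ζ := by
    rw [← zeta_mul_pow_eq_sigma, pow_zero_eq_zeta, natCoe_mul]
  have h : ((μ : ArithmeticFunction ℝ) * ((σ 0 : ArithmeticFunction ℕ) : ArithmeticFunction ℝ)) q = 1 := by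
    rw [hσ, ← mul_assoc, coe_moebius_mul_coe_zeta, one_mul, natCoe_apply, zeta_apply_ne hq,
      Nat.cast_one]
  rw [mul_apply, Nat.sum_divisorsAntidiagonal fun a b ↦ (μ : ArithmeticFunction ℝ) a *
    ((σ 0 : ArithmeticFunction ℕ) : ArithmeticFunction ℝ) b] at h
  rw [← h]
  refine Finset.sum_congr rfl fun d _ ↦ ?_
  rw [intCoe_apply, natCoe_apply, sigma_zero_apply]

/-- `Σ_{d∣q} μ(d) log d·τ(q/d) = −log q` for `q ≥ 1` (`(μ·log) ∗ ζ = −Λ`, `Λ ∗ ζ = log`). [folklore] -/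
theorem sum_moebius_log_mul_card_divisors_div (q : ℕ) :
    ∑ d ∈ q.divisors, (μ d : ℝ) * Real.log d * ((q / d).divisors.card : ℝ) = -Real.log q := by
  set Lμ : ArithmeticFunction ℝ := (μ : ArithmeticFunction ℝ).pmul ArithmeticFunction.log with hLμ
  have h1 : Lμ * (ζ : ArithmeticFunction ℝ) = -Λ := by
    ext m
    rw [coe_mul_zeta_apply, ArithmeticFunction.neg_apply, ← sum_moebius_mul_log_eq]
    refine Finset.sum_congr rfl fun d _ ↦ ?_
    rw [hLμ, pmul_apply, intCoe_apply]
  have hσ : ((σ 0 : ArithmeticFunction ℕ) : ArithmeticFunction ℝ) =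
      (ζ : ArithmeticFunction ℝ) * ζ := by
    rw [← zeta_mul_pow_eq_sigma, pow_zero_eq_zeta, natCoe_mul]
  have h : (Lμ * ((σ 0 : ArithmeticFunction ℕ) : ArithmeticFunction ℝ)) q = -Real.log q := by
    rw [hσ, ← mul_assoc, h1]
    have hneg : (-Λ) * (ζ : ArithmeticFunction ℝ) = -(Λ * ζ) := by ring
    rw [hneg, ArithmeticFunction.neg_apply, vonMangoldt_mul_zeta, log_apply]
  rw [mul_apply, Nat.sum_divisorsAntidiagonal fun a b ↦ Lμ a *
    ((σ 0 : ArithmeticFunction ℕ) : ArithmeticFunction ℝ) b] at h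
  rw [← h]
  refine Finset.sum_congr rfl fun d _ ↦ ?_
  rw [hLμ, pmul_apply, intCoe_apply, log_apply, natCoe_apply, sigma_zero_apply]

/-! ### The unitary convolutions over the antidiagonal -/

/-- `Σ_{dk = q} |W(d)|·f_d(k) = W(q)`: for squarefree `q` every factorisation is coprime and
`|W(d)|τ(k)W(k) = μ(d)τ(k)·W(q)`; both sides vanish otherwise. [cite: KowalskiMichelVanderKam2000, Prop. 5.1 — derivation] -/
theorem sum_antidiagonal_absW_mul_copTauW {q : ℕ} (hq : q ≠ 0) :
    ∑ x ∈ q.divisorsAntidiagonal, |W x.1| * copTauW x.1 x.2 = W q := by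
  by_cases hsq : Squarefree q
  · have hterm : ∀ x ∈ q.divisorsAntidiagonal, |W x.1| * copTauW x.1 x.2 =
        W q * ((μ x.1 : ℝ) * (x.2.divisors.card : ℝ)) := by
      intro x hx
      have hx' := Nat.mem_divisorsAntidiagonal.1 hx
      have hsq' : Squarefree (x.1 * x.2) := by rw [hx'.1]; exact hsq
      have hcop : x.1.Coprime x.2 := Nat.coprime_of_squarefree_mul hsq'
      rw [copTauW_apply, if_pos hcop.symm, abs_W_eq, ← hx'.1,
        isMultiplicative_W'.map_mul_of_coprime hcop]
      ring
    rw [Finset.sum_congr rfl hterm, ← Finset.mul_sum,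
      Nat.sum_divisorsAntidiagonal fun a b ↦ (μ a : ℝ) * (b.divisors.card : ℝ),
      sum_moebius_mul_card_divisors_div hq, mul_one]
  · rw [W_eq_zero_of_not_squarefree hsq]
    refine Finset.sum_eq_zero fun x hx ↦ ?_
    have hx' := Nat.mem_divisorsAntidiagonal.1 hx
    rw [copTauW_apply]
    by_cases hcop : x.2.Coprime x.1
    · rw [if_pos hcop]
      have : ¬ (Squarefree x.1 ∧ Squarefree x.2) := by
        intro h
        apply hsq
        rw [← hx'.1]
        exact Nat.squarefree_mul_iff.2 ⟨hcop.symm, h.1, h.2⟩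
      rcases not_and_or.1 this with h1 | h2
      · rw [W_eq_zero_of_not_squarefree h1]; simp
      · rw [W_eq_zero_of_not_squarefree h2]; simp
    · rw [if_neg hcop, mul_zero]

/-- `Σ_{dk = q} |W(d)| log d·f_d(k) = −W(q) log q` (`Σ_{d∣q} μ(d) log d τ(q/d) = −log q`).
[cite: KowalskiMichelVanderKam2000, Prop. 5.1 — derivation] -/
theorem sum_antidiagonal_absW_log_mul_copTauW (q : ℕ) :
    ∑ x ∈ q.divisorsAntidiagonal, |W x.1| * Real.log x.1 * copTauW x.1 x.2 = -(W q * Real.log q) := by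
  by_cases hsq : Squarefree q
  · have hterm : ∀ x ∈ q.divisorsAntidiagonal, |W x.1| * Real.log x.1 * copTauW x.1 x.2 =
        W q * ((μ x.1 : ℝ) * Real.log x.1 * (x.2.divisors.card : ℝ)) := by
      intro x hx
      have hx' := Nat.mem_divisorsAntidiagonal.1 hx
      have hsq' : Squarefree (x.1 * x.2) := by rw [hx'.1]; exact hsq
      have hcop : x.1.Coprime x.2 := Nat.coprime_of_squarefree_mul hsq'
      rw [copTauW_apply, if_pos hcop.symm, abs_W_eq, ← hx'.1,
        isMultiplicative_W'.map_mul_of_coprime hcop]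
      ring
    rw [Finset.sum_congr rfl hterm, ← Finset.mul_sum,
      Nat.sum_divisorsAntidiagonal fun a b ↦ (μ a : ℝ) * Real.log a * (b.divisors.card : ℝ),
      sum_moebius_log_mul_card_divisors_div q]
    ring
  · rw [W_eq_zero_of_not_squarefree hsq, zero_mul, neg_zero]
    refine Finset.sum_eq_zero fun x hx ↦ ?_
    have hx' := Nat.mem_divisorsAntidiagonal.1 hx
    rw [copTauW_apply]
    by_cases hcop : x.2.Coprime x.1
    · rw [if_pos hcop]
      have : ¬ (Squarefree x.1 ∧ Squarefree x.2) := by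
        intro h
        apply hsq
        rw [← hx'.1]
        exact Nat.squarefree_mul_iff.2 ⟨hcop.symm, h.1, h.2⟩
      rcases not_and_or.1 this with h1 | h2
      · rw [W_eq_zero_of_not_squarefree h1]; simp
      · rw [W_eq_zero_of_not_squarefree h2]; simp
    · rw [if_neg hcop, mul_zero]

/-- `Σ_{dp = q, p prime, p ∤ d} |W(d)|·log p/(p+1) = |W(q)| log q`: for squarefree `q` and `p ∣ q`,
`|W(q/p)| = (p+1)|W(q)|` and `Σ_{p∣q} log p = log q`; both sides vanish otherwise. [folklore] -/
theorem sum_antidiagonal_absW_prime (q : ℕ) :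
    ∑ x ∈ q.divisorsAntidiagonal,
        (if x.2.Prime ∧ ¬ x.2 ∣ x.1 then |W x.1| * (Real.log x.2 / ((x.2 : ℝ) + 1)) else 0) =
      |W q| * Real.log q := by
  rw [Nat.sum_divisorsAntidiagonal' fun a b ↦
    (if b.Prime ∧ ¬ b ∣ a then |W a| * (Real.log b / ((b : ℝ) + 1)) else 0)]
  by_cases hsq : Squarefree q
  · -- restrict to the prime divisors
    have hval : ∀ p ∈ q.divisors,
        (if p.Prime ∧ ¬ p ∣ q / p then |W (q / p)| * (Real.log p / ((p : ℝ) + 1)) else 0) =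
          if p.Prime then |W q| * Real.log p else 0 := by
      intro p hp
      have hpq := Nat.dvd_of_mem_divisors hp
      by_cases hpr : p.Prime
      · have hndvd : ¬ p ∣ q / p := by
          intro h
          have : p * p ∣ q := by
            have := Nat.mul_dvd_mul_left p h
            rwa [Nat.mul_div_cancel' hpq] at this
          exact hpr.not_isUnit (hsq p this)
        rw [if_pos ⟨hpr, hndvd⟩, if_pos hpr]
        have hcop : (q / p).Coprime p :=
          (Nat.coprime_comm.1 ((Nat.Prime.coprime_iff_not_dvd hpr).2 hndvd))
        have hWq : |W q| = |W (q / p)| * ((p : ℝ) + 1)⁻¹ := by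
          conv_lhs => rw [← Nat.div_mul_cancel hpq]
          rw [isMultiplicative_W'.map_mul_of_coprime hcop, abs_mul]
          congr 1
          have h1 := W_apply_prime_pow' (i := 1) hpr one_ne_zero
          rw [pow_one] at h1
          rw [h1, if_pos rfl, abs_neg, abs_of_nonneg (by positivity)]
        rw [hWq]
        have : ((p : ℝ) + 1) ≠ 0 := by positivity
        field_simp
      · rw [if_neg (fun h ↦ hpr h.1), if_neg hpr]
    rw [Finset.sum_congr rfl hval, ← Finset.sum_filter]
    have hfilt : q.divisors.filter Nat.Prime = q.primeFactors := by
      ext p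
      simp only [Finset.mem_filter, Nat.mem_divisors, Nat.mem_primeFactors]
      tauto
    rw [hfilt, ← Finset.mul_sum]
    congr 1
    conv_rhs => rw [← Nat.prod_primeFactors_of_squarefree hsq]
    rw [Nat.cast_prod, Real.log_prod]
    intro p hp
    exact_mod_cast (Nat.prime_of_mem_primeFactors hp).ne_zero
  · rw [W_eq_zero_of_not_squarefree hsq, abs_zero, zero_mul]
    refine Finset.sum_eq_zero fun p hp ↦ ?_
    split_ifs with h
    · obtain ⟨hpr, hndvd⟩ := h
      have hpq := Nat.dvd_of_mem_divisors hp
      have hns : ¬ Squarefree (q / p) := by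
        intro h'
        apply hsq
        rw [← Nat.div_mul_cancel hpq]
        refine Nat.squarefree_mul_iff.2 ⟨?_, h', hpr.squarefree⟩
        exact Nat.coprime_comm.1 ((Nat.Prime.coprime_iff_not_dvd hpr).2 hndvd)
      rw [W_eq_zero_of_not_squarefree hns]; simp
    · rfl


/-! ### The three global collapses -/

/-- **`Σ_{n ≤ M} |W(n)|·S(M/n;n) = W₂(M)`** (`= Σ_{m ≤ M} W(m)log²(M/m)`): the unitary convolution
`|W| ⋆ τW = W`. [cite: KowalskiMichelVanderKam2000, Prop. 5.1 — derivation (the slope constant ζ(2)²∫P″²)] -/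
theorem sum_absW_coprimeSum (M : ℝ) :
    ∑ n ∈ Icc 1 ⌊M⌋₊, |W n| * coprimeSum n (M / n) = weightLogPowSum 2 M := by
  set N := ⌊M⌋₊ with hN
  have h1 : ∑ n ∈ Icc 1 N, |W n| * coprimeSum n (M / n) =
      ∑ n ∈ Ioc 0 N, ∑ k ∈ Ioc 0 (N / n),
        |W n| * copTauW n k * Real.log (M / ((n * k : ℕ) : ℝ)) ^ 2 := by
    rw [Icc_one_eq_Ioc_zero]
    refine Finset.sum_congr rfl fun n _ ↦ ?_
    rw [coprimeSum, Nat.floor_div_natCast, ← hN, Icc_one_eq_Ioc_zero, Finset.mul_sum]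
    refine Finset.sum_congr rfl fun k _ ↦ ?_
    push_cast
    rw [div_div]
    ring
  rw [h1, ← SiegelWalfiszLiouville.sum_Ioc_sum_divisorsAntidiagonal_eq
    (fun a b ↦ |W a| * copTauW a b * Real.log (M / ((a * b : ℕ) : ℝ)) ^ 2) N,
    weightLogPowSum, ← hN, Icc_one_eq_Ioc_zero]
  refine Finset.sum_congr rfl fun q hq ↦ ?_
  have hq0 : q ≠ 0 := by have := (Finset.mem_Ioc.1 hq).1; omega
  have h2 : ∑ x ∈ q.divisorsAntidiagonal, |W x.1| * copTauW x.1 x.2 * Real.log (M / ((x.1 * x.2 : ℕ) : ℝ)) ^ 2 =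
      (∑ x ∈ q.divisorsAntidiagonal, |W x.1| * copTauW x.1 x.2) * Real.log (M / q) ^ 2 := by
    rw [Finset.sum_mul]
    refine Finset.sum_congr rfl fun x hx ↦ ?_
    rw [(Nat.mem_divisorsAntidiagonal.1 hx).1]
  rw [h2, sum_antidiagonal_absW_mul_copTauW hq0]

/-- **`Σ_{n ≤ M} |W(n)| log n·S(M/n;n) = W₃(M) − log M·W₂(M)`** (`M > 0`): the unitary convolution
`(|W|·log) ⋆ τW = −W·log` and `log q = log M − log(M/q)`.
[cite: KowalskiMichelVanderKam2000, Prop. 5.1 — derivation (the constant ζ(2)²P′(1)²)] -/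
theorem sum_absW_log_coprimeSum {M : ℝ} (hM : 0 < M) :
    ∑ n ∈ Icc 1 ⌊M⌋₊, |W n| * Real.log n * coprimeSum n (M / n) =
      weightLogPowSum 3 M - Real.log M * weightLogPowSum 2 M := by
  set N := ⌊M⌋₊ with hN
  have h1 : ∑ n ∈ Icc 1 N, |W n| * Real.log n * coprimeSum n (M / n) =
      ∑ n ∈ Ioc 0 N, ∑ k ∈ Ioc 0 (N / n),
        |W n| * Real.log n * copTauW n k * Real.log (M / ((n * k : ℕ) : ℝ)) ^ 2 := by
    rw [Icc_one_eq_Ioc_zero]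
    refine Finset.sum_congr rfl fun n _ ↦ ?_
    rw [coprimeSum, Nat.floor_div_natCast, ← hN, Icc_one_eq_Ioc_zero, Finset.mul_sum]
    refine Finset.sum_congr rfl fun k _ ↦ ?_
    push_cast
    rw [div_div]
    ring
  rw [h1, ← SiegelWalfiszLiouville.sum_Ioc_sum_divisorsAntidiagonal_eq
    (fun a b ↦ |W a| * Real.log a * copTauW a b * Real.log (M / ((a * b : ℕ) : ℝ)) ^ 2) N,
    weightLogPowSum, weightLogPowSum, ← hN, Icc_one_eq_Ioc_zero, Finset.mul_sum,
    ← Finset.sum_sub_distrib]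
  refine Finset.sum_congr rfl fun q hq ↦ ?_
  have hq0 : q ≠ 0 := by have := (Finset.mem_Ioc.1 hq).1; omega
  have hq0' : (q : ℝ) ≠ 0 := by exact_mod_cast hq0
  have h2 : ∑ x ∈ q.divisorsAntidiagonal,
      |W x.1| * Real.log x.1 * copTauW x.1 x.2 * Real.log (M / ((x.1 * x.2 : ℕ) : ℝ)) ^ 2 =
      (∑ x ∈ q.divisorsAntidiagonal, |W x.1| * Real.log x.1 * copTauW x.1 x.2) *
        Real.log (M / q) ^ 2 := by
    rw [Finset.sum_mul]
    refine Finset.sum_congr rfl fun x hx ↦ ?_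
    rw [(Nat.mem_divisorsAntidiagonal.1 hx).1]
  rw [h2, sum_antidiagonal_absW_log_mul_copTauW q, Real.log_div hM.ne' hq0']
  ring

/-- **`Σ_{n ≤ M} |W(n)|·P_n = Σ_{n ≤ M} |W(n)| log n·S(M/n;n)`**: collecting the pairs `(n, p)` by
their product (`|W(n)| = (p+1)|W(np)|`, `Σ_{p∣q} log p = log q`).
[cite: KowalskiMichelVanderKam2000, Prop. 5.1 — derivation] -/
theorem sum_absW_primeSum (M : ℝ) :
    ∑ n ∈ Icc 1 ⌊M⌋₊, |W n| * primeSum M n =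
      ∑ n ∈ Icc 1 ⌊M⌋₊, |W n| * Real.log n * coprimeSum n (M / n) := by
  set N := ⌊M⌋₊ with hN
  have h1 : ∑ n ∈ Icc 1 N, |W n| * primeSum M n =
      ∑ n ∈ Ioc 0 N, ∑ j ∈ Ioc 0 (N / n),
        (if j.Prime ∧ ¬ j ∣ n then |W n| * (Real.log j / ((j : ℝ) + 1)) else 0) *
          coprimeSum (n * j) (M / ((n * j : ℕ) : ℝ)) := by
    rw [Icc_one_eq_Ioc_zero]
    refine Finset.sum_congr rfl fun n _ ↦ ?_
    rw [primeSum, ← hN, Icc_one_eq_Ioc_zero, Finset.mul_sum]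
    refine Finset.sum_congr rfl fun j _ ↦ ?_
    split_ifs <;> ring
  rw [h1, ← SiegelWalfiszLiouville.sum_Ioc_sum_divisorsAntidiagonal_eq
    (fun a b ↦ (if b.Prime ∧ ¬ b ∣ a then |W a| * (Real.log b / ((b : ℝ) + 1)) else 0) *
      coprimeSum (a * b) (M / ((a * b : ℕ) : ℝ))) N, Icc_one_eq_Ioc_zero]
  refine Finset.sum_congr rfl fun q hq ↦ ?_
  have h2 : ∑ x ∈ q.divisorsAntidiagonal,
      (if x.2.Prime ∧ ¬ x.2 ∣ x.1 then |W x.1| * (Real.log x.2 / ((x.2 : ℝ) + 1)) else 0) *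
        coprimeSum (x.1 * x.2) (M / ((x.1 * x.2 : ℕ) : ℝ)) =
      (∑ x ∈ q.divisorsAntidiagonal,
        (if x.2.Prime ∧ ¬ x.2 ∣ x.1 then |W x.1| * (Real.log x.2 / ((x.2 : ℝ) + 1)) else 0)) *
        coprimeSum q (M / q) := by
    rw [Finset.sum_mul]
    refine Finset.sum_congr rfl fun x hx ↦ ?_
    rw [(Nat.mem_divisorsAntidiagonal.1 hx).1]
  rw [h2, sum_antidiagonal_absW_prime q]
end Summit.Parity.GeneralizedHardyLittlewood.Theorems.BeyondDiagonalBeatsQuarter.KernelFormXSq
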